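import Summits.HodgeConjecture.HodgeConjecture.Theorems.F0P3bBorelCharactersUnipotentTwo   -- ★ `antidiagonal_two_over_eq`, `glDiagonal_two_mem_unitaryGroupOfForm`, `mem_unipotentU_iff` (2×2 bookkeeping)
import HarnessLib

/-!
# R90-TF · S4 «Ch. 13.1–2» — (ORBIT)∕(SWAP) support, part (f₁): the UNIPOTENT WORD for the torus of `U(σ, Φ₂)(R) ≅ U(1,1)` —
# `d(x∕x′, x′∕x) = w(x) · w(x′)⁻¹`, `w(x) = u(x) · (w₀ u(−x⁻¹) w₀) · u(x)` for skew units `x, x′`; hence a subgroup containing `N` and `w₀ N w₀⁻¹`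
# contains `d(a, a⁻¹)` for every quotient `a = x∕x′` of skew units, and a representation trivial on `N` is trivial on these torus elements

Cell `hodgecm-mathlib`, crux H413 (`stmt-HodgeConjecture-24833`, lane `--supports … --as helper`), route of record `HCCMUnconditional`
(no route verbs; count-neutral).  Programme R90-TF (brief `director/R90-BRIEF.v2.md` 1f40d54518340a35), section S4 = Rogawski Ch. 13.1–2
(base `R90-C131`); seat R90-C131-p01 (g0); census `R90/R90-C131-p01/g0/CENSUS-orbit.md` 62930f5ed58633f2, road (f) «no `N`-trivial constituent of
`i(χ)` in Keys' case 2», Step 1, toward (SWAP) = B ED. 4 `_ldsSwap` ([Rogawski1990, §11.1 p. 161]).  THEOREMS ONLY (no `def`, no instance, no notation,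
no named fact, no `sorry`); imports ★ `Theorems/F0P3bBorelCharactersUnipotentTwo` only (its §1 `2 × 2` bookkeeping); generic: `R` a commutative ring,
`σ : R →+* R` any ring endomorphism, `Φ₂ = antidiag(1, 1)`, `G = U(σ, Φ₂)(R)`, `N ≤ G` the upper unipotent subgroup (★ `unipotentU`).

MATHEMATICS (the `SL₂` word `h(s) = w(s) w(1)⁻¹` [SpringerLAG1998, 8.1.4], ★ `diagSL2_eq_word`, adapted to the unitary group: the entries of `N` are the SKEW elements
`σ x = −x`, and the ratio of two skew units is `σ`-FIXED).  For a skew unit `x`: `u(x) = [[1, x], [0, 1]] ∈ N`; for `w₀ ∈ G` of matrix `Φ₂`,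
`w₀ u(y) w₀ = [[1, 0], [y, 1]]`; `w(x) := u(x) · w₀ u(−x⁻¹) w₀ · u(x) = [[0, x], [−x⁻¹, 0]]`; and `d(x x′⁻¹, x′ x⁻¹) · w(x′) = w(x)`.  So every
subgroup `K ≥ N ∪ w₀ N w₀⁻¹` contains `d(x∕x′, x′∕x)` (`glDiagonal_two_mem_of_unipotentU_le`), and a representation `π` of `G` with `π|_N = 1` has
`π(d(x∕x′, x′∕x)) = 1` (`apply_eq_one_of_unipotentU_trivial`) — at a non-split place every `σ`-fixed unit `a` of `L ⊗ L⁺_v` is such a quotient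
(`x = a δ₀`, `x′ = δ₀`, ★ `exists_skew_unit_localRing`), which Step 2 (`Theorems/R90S4U2NoUnipotentTrivialConstituent`) evaluates against the Jacquet
exponents `χ δ^{1∕2}`, `wχ δ^{1∕2}` of `i(χ)`.

HONEST LABEL: HC_CM is proved only modulo the 7 printed citations (2 remaining named inputs: hLiu418 = stmt-HodgeConjecture-24832,
h413 = stmt-HodgeConjecture-24833) until rung 0 closes; this file is `2 × 2` matrix algebra and discharges none of them.  REL ≠ ★ ≠ BUILT.

## References
[Rogawski1990] J. D. Rogawski, *Automorphic Representations of Unitary Groups in Three Variables* (1990), §1.9–§1.10 pp. 8–9 (`U(1,1) = U(Φ₂)`, `B`, `N`), §11.1 p. 161 ·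
[SpringerLAG1998] T. A. Springer, *Linear Algebraic Groups*, 2nd ed. (1998), 8.1.4 (`w_α(t)`, `h_α(t) = w_α(t) w_α(1)⁻¹`; ★ `diagSL2_eq_word`) · [Casselman1995] W. Casselman, *Introduction to the
theory of admissible representations of p-adic reductive groups* (1995), §6.4.
-/

set_option autoImplicit false
-- the mandated namespace (brief §3.4) repeats the single-problem summit's segment (`HodgeConjecture.HodgeConjecture`)
set_option linter.dupNamespace false

namespace Summit.HodgeConjecture.HodgeConjecture.R90.S4

open scoped MatrixGroups
open Literature.NumberTheory.Automorphic Literature.NumberTheory.Automorphic.UnitaryGroup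
open Summit.HodgeConjecture.HodgeConjecture.Cruxes.H413.F0P3bBorelCharactersUnipotentTwo

section Word

variable {R : Type*} [CommRing R] (σ : R →+* R)

/-- **The upper unipotent element `u(x) = [[1, x], [0, 1]]` lies in `U(σ, Φ₂)(R)` for SKEW `x` (`σ x = −x`)** — `ᵗ(σ u) Φ₂ u = [[0, 1], [1, x + σ x]]` —
and in `N`; packaged as an existence statement (no new definition). [cite: Rogawski1990, §1.10 p. 9] -/
theorem exists_unipotentU_two_coe_eq (x : R) (hx : σ x = -x) :
    ∃ u : ↥(unitaryGroupOfForm σ ((StdForm.antidiagonal 2).over R)), u ∈ unipotentU σ ((StdForm.antidiagonal 2).over R) ∧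
      ((u : GL (Fin 2) R) : Matrix (Fin 2) (Fin 2) R) = !![1, x; 0, 1] := by
  let U : GL (Fin 2) R :=
    ⟨!![1, x; 0, 1], !![1, -x; 0, 1], by rw [Matrix.mul_fin_two]; simp [Matrix.one_fin_two], by rw [Matrix.mul_fin_two]; simp [Matrix.one_fin_two]⟩
  have hU : (U : Matrix (Fin 2) (Fin 2) R) = !![1, x; 0, 1] := rfl
  have hmem : U ∈ unitaryGroupOfForm σ ((StdForm.antidiagonal 2).over R) := by
    rw [mem_unitaryGroupOfForm_iff, antidiagonal_two_over_eq, hU]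
    ext i j
    fin_cases i <;> fin_cases j <;>
      simp [Matrix.mul_apply, Fin.sum_univ_two, Matrix.map_apply, Matrix.transpose_apply, hx]
  refine ⟨⟨U, hmem⟩, ?_, hU⟩
  rw [mem_unipotentU_iff]
  refine ⟨?_, fun i => ?_⟩
  · intro i j hij
    change (U : Matrix (Fin 2) (Fin 2) R) i j = 0
    rw [hU]
    fin_cases i <;> fin_cases j <;> simp_all
  · change (U : Matrix (Fin 2) (Fin 2) R) i i = 1
    rw [hU]
    fin_cases i <;> simp

/-- `σ` of the inverse of a skew unit is minus the inverse. [cite: Rogawski1990, §1.9 p. 8] -/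
theorem map_units_inv_of_skew (x : Rˣ) (hx : σ x = -x) : σ ((x⁻¹ : Rˣ) : R) = -((x⁻¹ : Rˣ) : R) := by
  have h1 : σ ((x⁻¹ : Rˣ) : R) * (x : R) = -1 := by
    have h := congrArg σ (x.inv_mul : ((x⁻¹ : Rˣ) : R) * (x : R) = 1)
    rw [map_mul, map_one, hx, mul_neg, neg_eq_iff_eq_neg] at h
    exact h
  calc σ ((x⁻¹ : Rˣ) : R) = σ ((x⁻¹ : Rˣ) : R) * (x : R) * ((x⁻¹ : Rˣ) : R) := by rw [mul_assoc, x.mul_inv, mul_one]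
    _ = -((x⁻¹ : Rˣ) : R) := by rw [h1, neg_one_mul]

/-- The quotient of two skew units is `σ`-fixed. [cite: Rogawski1990, §1.9 p. 8] -/
theorem map_mul_inv_of_skew (x x' : Rˣ) (hx : σ x = -x) (hx' : σ x' = -x') :
    σ ((x * x'⁻¹ : Rˣ) : R) = ((x * x'⁻¹ : Rˣ) : R) := by
  rw [Units.val_mul, map_mul, hx, map_units_inv_of_skew σ x' hx', neg_mul_neg]

/-- **THE WORD.**  Let `K ≤ U(σ, Φ₂)(R)` be a subgroup containing `N` and `w₀ N w₀⁻¹` for an element `w₀` of matrix `Φ₂`.  Then for skew units `x, x′`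
(`σ x = −x`, `σ x′ = −x′`) every element of `U(σ, Φ₂)(R)` with matrix `diag(x x′⁻¹, x′ x⁻¹)` lies in `K`:
`d(x x′⁻¹, x′ x⁻¹) = w(x) w(x′)⁻¹`, `w(y) = u(y) · w₀ u(−y⁻¹) w₀⁻¹ · u(y)` (`= [[0, y], [−y⁻¹, 0]]`).
[cite: SpringerLAG1998, 8.1.4] [cite: Rogawski1990, §1.10 p. 9] -/
theorem mem_of_unipotentU_le_of_coe_eq_diagonal (K : Subgroup ↥(unitaryGroupOfForm σ ((StdForm.antidiagonal 2).over R)))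
    (w₀ : ↥(unitaryGroupOfForm σ ((StdForm.antidiagonal 2).over R)))
    (hw₀ : ((w₀ : GL (Fin 2) R) : Matrix (Fin 2) (Fin 2) R) = (StdForm.antidiagonal 2).over R)
    (hN : unipotentU σ ((StdForm.antidiagonal 2).over R) ≤ K)
    (hNw : ∀ n ∈ unipotentU σ ((StdForm.antidiagonal 2).over R), w₀ * n * w₀⁻¹ ∈ K)
    (x x' : Rˣ) (hx : σ x = -x) (hx' : σ x' = -x')
    (g : ↥(unitaryGroupOfForm σ ((StdForm.antidiagonal 2).over R)))
    (hg : ((g : GL (Fin 2) R) : Matrix (Fin 2) (Fin 2) R) = Matrix.diagonal ![((x * x'⁻¹ : Rˣ) : R), ((x' * x⁻¹ : Rˣ) : R)]) :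
    g ∈ K := by
  -- the four unipotent elements
  obtain ⟨u, hu, hcu⟩ := exists_unipotentU_two_coe_eq σ (x : R) hx
  obtain ⟨u', hu', hcu'⟩ := exists_unipotentU_two_coe_eq σ (x' : R) hx'
  obtain ⟨p, hp, hcp⟩ := exists_unipotentU_two_coe_eq σ (-((x⁻¹ : Rˣ) : R))
    (by rw [map_neg, map_units_inv_of_skew σ x hx, neg_neg])
  obtain ⟨p', hp', hcp'⟩ := exists_unipotentU_two_coe_eq σ (-((x'⁻¹ : Rˣ) : R))
    (by rw [map_neg, map_units_inv_of_skew σ x' hx', neg_neg])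
  -- `w₀⁻¹ = w₀` (`Φ₂² = 1`)
  have hw₀inv : w₀⁻¹ = w₀ := by
    rw [inv_eq_iff_mul_eq_one]
    apply Subtype.ext
    apply Units.ext
    rw [Subgroup.coe_mul, Units.val_mul, hw₀, Subgroup.coe_one, Units.val_one, antidiagonal_two_over_eq, Matrix.mul_fin_two]
    simp [Matrix.one_fin_two]
  -- the word: `g * (u' (w₀ p' w₀⁻¹) u') = u (w₀ p w₀⁻¹) u`
  have hword : g * (u' * (w₀ * p' * w₀⁻¹) * u') = u * (w₀ * p * w₀⁻¹) * u := by
    apply Subtype.ext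
    apply Units.ext
    simp only [Subgroup.coe_mul, Units.val_mul, hw₀inv, hg, hcu, hcu', hcp, hcp', hw₀, antidiagonal_two_over_eq]
    ext i j
    fin_cases i <;> fin_cases j <;>
      simp [Matrix.mul_apply, Fin.sum_univ_two, Matrix.diagonal]
    -- the remaining entry `(1, 0)`: `x' · x⁻¹ · x'⁻¹ = x⁻¹`
    rw [mul_comm (x' : R) _, mul_assoc, x'.mul_inv, mul_one]
  have hmem : u * (w₀ * p * w₀⁻¹) * u * (u' * (w₀ * p' * w₀⁻¹) * u')⁻¹ ∈ K :=
    K.mul_mem (K.mul_mem (K.mul_mem (hN hu) (hNw p hp)) (hN hu)) (K.inv_mem (K.mul_mem (K.mul_mem (hN hu') (hNw p' hp')) (hN hu')))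
  have hgeq : g = u * (w₀ * p * w₀⁻¹) * u * (u' * (w₀ * p' * w₀⁻¹) * u')⁻¹ := eq_mul_inv_of_mul_eq hword
  rw [hgeq]
  exact hmem

/-- **A representation trivial on `N` is trivial on the torus elements `d(x∕x′, x′∕x)`** (`x, x′` skew units): apply THE WORD to the subgroup
`{g | π g = 1}` (it contains `w₀ N w₀⁻¹` because `π(w₀ n w₀⁻¹) = π(w₀) π(n) π(w₀)⁻¹ = 1`). [cite: Casselman1995, §6.4] [cite: Rogawski1990, §11.1 p. 161] -/
theorem apply_eq_one_of_unipotentU_trivial {k V : Type*} [CommRing k] [AddCommGroup V] [Module k V]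
    (π : Representation k ↥(unitaryGroupOfForm σ ((StdForm.antidiagonal 2).over R)) V)
    (hN : ∀ n ∈ unipotentU σ ((StdForm.antidiagonal 2).over R), π n = 1)
    (w₀ : ↥(unitaryGroupOfForm σ ((StdForm.antidiagonal 2).over R)))
    (hw₀ : ((w₀ : GL (Fin 2) R) : Matrix (Fin 2) (Fin 2) R) = (StdForm.antidiagonal 2).over R)
    (x x' : Rˣ) (hx : σ x = -x) (hx' : σ x' = -x')
    (g : ↥(unitaryGroupOfForm σ ((StdForm.antidiagonal 2).over R)))
    (hg : ((g : GL (Fin 2) R) : Matrix (Fin 2) (Fin 2) R) = Matrix.diagonal ![((x * x'⁻¹ : Rˣ) : R), ((x' * x⁻¹ : Rˣ) : R)]) :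
    π g = 1 := by
  let K : Subgroup ↥(unitaryGroupOfForm σ ((StdForm.antidiagonal 2).over R)) :=
    { carrier := {g | π g = 1}
      mul_mem' := fun {a b} ha hb => by
        change π (a * b) = 1
        rw [map_mul, show π a = 1 from ha, show π b = 1 from hb, mul_one]
      one_mem' := map_one π
      inv_mem' := fun {a} ha => by
        change π a⁻¹ = 1
        have h : π a⁻¹ * π a = 1 := by rw [← map_mul, inv_mul_cancel, map_one]
        rwa [show π a = 1 from ha, mul_one] at h }
  have hNK : unipotentU σ ((StdForm.antidiagonal 2).over R) ≤ K := fun n hn => hN n hn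
  have hNwK : ∀ n ∈ unipotentU σ ((StdForm.antidiagonal 2).over R), w₀ * n * w₀⁻¹ ∈ K := by
    intro n hn
    change π (w₀ * n * w₀⁻¹) = 1
    rw [map_mul, map_mul, hN n hn, mul_one, ← map_mul, mul_inv_cancel, map_one]
  exact mem_of_unipotentU_le_of_coe_eq_diagonal σ K w₀ hw₀ hNK hNwK x x' hx hx' g hg

end Word

end Summit.HodgeConjecture.HodgeConjecture.R90.S4
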